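import Literature.Combinatorics.SetFamily.OrderShattering

/-!
# Nine-type configurations: counting principle of the order-shattering route

If a family `ℱ` of (at least) `#𝒯` sets has all its order-shattered sets (along some duplicate-free
coordinate list, `Literature.Combinatorics.SetFamily.osh`) with complement in the good family `𝔊`, then
`#𝒯 ≤ #𝔊` — because `#osh(ℱ) = #ℱ` (Anstee–Rónyai–Sali) and complementation is injective.  This is the
assembly step of the order-shattering route to `nine_card_le` (`prim-bnk-1` gen 18 memo §15): with
`ℱ = {pᶜ : p an H-point} ∪ {t : t an L-point}` it remains to show that every order-shattered set of `ℱ`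
is the complement of a good, i.e. lies in a facet `q \ p`, `pᶜ ∩ qᶜ` or `p ∩ q` of a compatible pair.
-/

namespace Summit.CriticalPhenomena.PercolationContinuityZ3.Theorems

namespace NineType

open Finset Literature.Combinatorics.SetFamily

variable {α : Type*} [DecidableEq α] [Fintype α]

/-- **Counting principle of the order-shattering route** (memo §15): if a family `ℱ` of at least `#𝒯`
sets inside a duplicate-free coordinate list has all its order-shattered sets with complement in `𝔊`,
then `#𝒯 ≤ #𝔊`. [this work] -/
theorem card_le_card_of_osh_compl_mem (𝒯 𝔊 ℱ : Finset (Finset α)) (hcard : #𝒯 ≤ #ℱ)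
    (l : List α) (hl : l.Nodup) (hF : ∀ F ∈ ℱ, F ⊆ l.toFinset)
    (hgood : ∀ S ∈ osh l ℱ, Sᶜ ∈ 𝔊) : #𝒯 ≤ #𝔊 := by
  rw [← card_osh l hl ℱ hF] at hcard
  refine hcard.trans (Finset.card_le_card_of_injOn (fun S => Sᶜ) (fun S hS => hgood S hS) ?_)
  intro S _ S' _ h
  exact compl_injective h

/-- The face test used by the route: a set `S` is the complement of a good as soon as it lies in
`q \ p` for an HL-compatible pair (`p ∪ qᶜ ∈ 𝔊`), since `𝔊` is an up-set. [this work] -/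
theorem compl_mem_of_subset_sdiff (𝔊 : Finset (Finset α))
    (hG : ∀ g ∈ 𝔊, ∀ g' : Finset α, g ⊆ g' → g' ∈ 𝔊)
    (p q S : Finset α) (hgood : p ∪ qᶜ ∈ 𝔊) (hS : S ⊆ q \ p) : Sᶜ ∈ 𝔊 := by
  refine hG _ hgood _ ?_
  intro y hy
  rw [Finset.mem_compl]
  intro hyS
  have h := hS hyS
  rw [Finset.mem_sdiff] at h
  rcases Finset.mem_union.1 hy with hyp | hyq
  · exact h.2 hyp
  · exact (Finset.mem_compl.1 hyq) h.1

/-- The member family of the order-shattering route — complements of the H-points `𝒯 ∖ L` and the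
L-points `L` themselves — has exactly `#𝒯` members under COV. [this work, memo §15] -/
theorem card_oshFamily (𝒯 L : Finset (Finset α)) (hL : L ⊆ 𝒯)
    (hcov : ∀ s ∈ 𝒯, ∀ s' ∈ 𝒯, s ≠ s' → s ∪ s' ≠ univ) : #(((𝒯 \ L).image compl) ∪ L) = #𝒯 := by
  have hdisj : Disjoint ((𝒯 \ L).image compl) L := by
    rw [Finset.disjoint_left]
    intro F hF hFL
    rcases Finset.mem_image.1 hF with ⟨p, hp, rfl⟩
    rcases Finset.mem_sdiff.1 hp with ⟨hp𝒯, hpL⟩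
    have hne : p ≠ pᶜ := fun h => hpL (h ▸ hFL)
    apply hcov p hp𝒯 pᶜ (hL hFL) hne
    exact Finset.union_compl p
  rw [Finset.card_union_of_disjoint hdisj, Finset.card_image_of_injective _ compl_injective,
    Finset.card_sdiff_add_card_eq_card hL]

/-- **`#𝒯 ≤ #𝔊` from an ordering** (the order-shattering route, memo §15): if, for some choice `L ⊆ 𝒯` of
L-points and some duplicate-free list `l` of all coordinates, every order-shattered set of the member family
`(𝒯 ∖ L)ᶜ ∪ L` (complements of H-points, L-points themselves) has its complement in `𝔊`, then `#𝒯 ≤ #𝔊`.  (The remaining ORDERING LEMMA asserts that such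
`L, l` exist for every CONT/COV nine-type configuration, the faces being contained in facets `q \ p`,
`pᶜ ∩ qᶜ`, `p ∩ q` of HL/HH/LL-compatible pairs.) [this work] -/
theorem card_le_card_of_ordering (𝒯 𝔊 : Finset (Finset α))
    (hcov : ∀ s ∈ 𝒯, ∀ s' ∈ 𝒯, s ≠ s' → s ∪ s' ≠ univ)
    (L : Finset (Finset α)) (hL : L ⊆ 𝒯) (l : List α) (hl : l.Nodup) (hluniv : ∀ x : α, x ∈ l)
    (hgood : ∀ S ∈ osh l (((𝒯 \ L).image compl) ∪ L), Sᶜ ∈ 𝔊) : #𝒯 ≤ #𝔊 :=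
  card_le_card_of_osh_compl_mem 𝒯 𝔊 (((𝒯 \ L).image compl) ∪ L) (card_oshFamily 𝒯 L hL hcov).symm.le l hl
    (fun _ _ y _ => List.mem_toFinset.2 (hluniv y)) hgood

end NineType

end Summit.CriticalPhenomena.PercolationContinuityZ3.Theorems
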